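import Summits.BirchSwinnertonDyer.Rank1Residual.ManinAdditive.EvenKummerShimuraNodes
import Summits.BirchSwinnertonDyer.BirchSwinnertonDyer.Theorems.ManinLocalTwoThreeSqRootMonodromyOfAutomorphy
import Summits.BirchSwinnertonDyer.BirchSwinnertonDyer.Theorems.ManinLocalTwoThreeEtaQuotientInvariantOfHalfNewman
import Summits.BirchSwinnertonDyer.BirchSwinnertonDyer.Theorems.ManinLocalTwoThreeSquareRootDescent
import HarnessLib

/-!
# E-an-237 `EvenKummerRepCongruencePeriodic` HOLDS: an all-even cuspidal Kummer representative of `Ξ_T` makes the σ-square root of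
# every half-period of `T` periodic under `c·{∞,γ∞}_f` for all `γ ∈ Γ₀(N) ∩ Γ(8N)`
(route `ManinLocalTwoThree`, crux C2 `ManinOddAtFour` stmt-BirchSwinnertonDyer-22967; cell bsd-f2-manin, prover p2 gen 20; an's TURNKEY P-an-g42-1,
MEMO-an §87; `--supports stmt-BirchSwinnertonDyer-22967`)

THE PROOF (squares only — no square-root dictionary, no holomorphic extension, no (β) formal square root is needed):
* from the representative `Ξ_T·B²·qⁿ¹ = qⁿ²·g·A²` (`IsCuspidalKummerRep`, `r` Newman of weight `0`, `g` the unit series of `r`, `A/B = F̂_A/Ĝ_B ∈ K_N`):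
  `Ξ̂ = q^{n₂−n₁}·ĝ·(Â/B̂)²` (`SquareRootDescent.laurent_sq_eq_of_rep`) and `η̂_r = q^{S₁(r)/24}·ĝ = q^{n₂−n₁}·ĝ` (N1₂
  `sub_eq_sum_div_of_isCuspidalKummerRep`, `etaLaurent_eq_of_isEtaUnitSeries`); M1 WITH WITNESSES (`etaLaurent_presentation`): `η̂_r·Ê_G = Ê_F` for
  the η-cusp-forms `E_F = η_{r+24n}`, `E_G = η_{24n}` of `ModularFunctionFieldEta`, with `E_F = η_r·E_G` POINTWISE; hence the power-series identity
  `Ξ_ℂ·Ĝ_B²·Ê_G = Ê_F·F̂_A²` among `Ξ` and `q`-expansions of Γ₀(N)-modular forms only (`kummer_qExpansion_identity`);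
* evaluation near `i∞` (S1₂ `kummerSquareAnalyticDictionary`, `hasSum_qExpansion_modularForm_gamma0`, Cauchy products): `Ξ^an·G_B²·E_G = E_F·F_A²`,
  and `E_F = η_r·E_G = η_s²·E_G` (`s = r/2`), `E_G ≠ 0`: **`(η_s·F_A)² = Ξ^an·G_B² = c²C·(t_s·V_p)²·G_B²`** (S3₂, the given half-period `p`);
* the carrier `F = η_s·F_A` is holomorphic and, for `γ ∈ Γ₀(N) ∩ Γ(8N)`, `F(γτ) = j(γ,τ)^k F(τ)` because **`η_s` is `Γ(8N)`-invariant**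
  (p2 g20 `EtaHalfNewman.etaQuotient_smul_of_mem_Gamma_eight_mul`: `Σ s_δ = 0`, `12 ∣ Σ δs_δ`, `12 ∣ Σ (N/δ)s_δ` are the halves of Newman's
  congruences for `r`); `G = G_B` likewise; so the generalised square-root monodromy `EvenKummerCongruence.sigmaSqRootMonodromy_of_automorphy`
  (p2 g20, S4₂ for arbitrary holomorphic carriers) gives the periodicity of `V_p`.
* `evenKummerRepCongruencePeriodic_holds : KummerShimuraTwo.EvenKummerRepCongruencePeriodic` — BY NAME.
CONSEQUENCES already in the tree (an g42, `EvenKummerShimuraNodes` / `…EvenKummerShimuraPosition`): 6b-res♮|_A and 6b‴|_A modulo F★ ∧ F♮ ∧ CES;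
6b-res|_B ⟸ E-an-152|_B ∧ E-an-152b|_B ∧ print.  HONEST FRAMING: C2 `ManinOddAtFour`, E-an-152/152b, C3, Manin's conjecture remain OPEN; BSD is
not proved by this.  No definitions, no sorry. [cite: Newman1959] [cite: Savitt2025, Thm. 1] [cite: Manin1972, Prop. 1.4 (shape)] [folklore]
-/

set_option autoImplicit false
-- lint-debt: the directory name repeats the summit name (sibling precedent `ManinLocalTwoThreeSquareRootDescent.lean`)
set_option linter.dupNamespace false

noncomputable section

open PowerSeries CongruenceSubgroup Complex
open scoped MatrixGroups ModularForm PeriodPair UpperHalfPlane Manifold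
open WeierstrassCurve Literature.NumberTheory.EllipticCurves Literature.NumberTheory.EllipticCurves.ModularForms
open Summit.BirchSwinnertonDyer.Rank1Residual.ManinAdditive
open Summit.BirchSwinnertonDyer.Rank1Residual.ManinAdditive.CuspidalKummer
open Summit.BirchSwinnertonDyer.Rank1Residual.ManinAdditive.KummerCubeMonodromy
open Summit.BirchSwinnertonDyer.BirchSwinnertonDyer.Theorems.ManinLocalTwoThree.KummerCubeSigmaLeaves
open Summit.BirchSwinnertonDyer.BirchSwinnertonDyer.Theorems.ManinLocalTwoThree.KummerCubeAnalytic
open Summit.BirchSwinnertonDyer.BirchSwinnertonDyer.Theorems.ManinLocalTwoThree.SigmaSquareRoot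

namespace Summit.BirchSwinnertonDyer.BirchSwinnertonDyer.Theorems.ManinLocalTwoThree.EvenKummerCongruence

/-! ## §1 M1 with witnesses: `η̂_r·Ê_G = Ê_F`, `E_F = η_r·E_G` pointwise -/

section Presentation

open UpperHalfPlane hiding I
open ModularFormClass Function
open Summit.BirchSwinnertonDyer.Rank1Residual.ManinAdditive.ModularFunctionFieldEta

/-- **M1 with explicit witnesses.**  For `r` satisfying Newman's weight-`0` conditions at level `M`: Γ₀(M)-modular forms `E_F = η_{r + 24n}`,
`E_G = η_{24n}` (`n = padN M r`) of weight `wt M r` with `E_G ≠ 0` pointwise, `E_F = η_r·E_G` POINTWISE on `ℍ`, and `η̂_r·Ê_G = Ê_F` for the Laurent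
`q`-series `η̂_r = etaLaurent M r` — the tree's `etaLaurent_mem_modularFunctionField` (an, M1) with its witnesses exported. [folklore] -/
theorem etaLaurent_presentation (M : ℕ) [NeZero M] (s : ℕ → ℤ) (hs : NewmanCond M s 0) :
    ∃ (k : ℤ) (F G : ModularForm (Gamma0 M) k), (∀ τ : ℍ, G τ ≠ 0) ∧ (∀ τ : ℍ, F τ = etaQuotient M s τ * G τ) ∧
      etaLaurent M s * qExpansionL M G = qExpansionL M F := by
  have hM : M ≠ 0 := NeZero.ne M
  have hMmem : M ∈ M.divisors := Nat.mem_divisors_self M hM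
  have hk := even_wt M s
  have hcF := newmanCond_expF M s hs
  have hcG := newmanCond_expG M s
  have hordF : ∀ t ∈ M.divisors, 0 < cuspOrder24 M (expF M s) t := fun t _ ↦
    cuspOrder24_pos_of_pos hM (fun δ hδ ↦ expF_pos M s hδ) t
  have hordG : ∀ t ∈ M.divisors, 0 < cuspOrder24 M (expG M s) t := fun t _ ↦
    cuspOrder24_pos_of_pos hM (fun δ _ ↦ expG_pos M s δ) t
  let F : ModularForm (Gamma0 M) (wt M s) :=
    ((etaQuotientCuspForm M (expF M s) (wt M s) hk hcF hordF : CuspForm (Gamma0 M) (wt M s)) :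
      ModularForm (Gamma0 M) (wt M s))
  let G : ModularForm (Gamma0 M) (wt M s) :=
    ((etaQuotientCuspForm M (expG M s) (wt M s) hk hcG hordG : CuspForm (Gamma0 M) (wt M s)) :
      ModularForm (Gamma0 M) (wt M s))
  have hFcoe : ∀ τ : ℍ, F τ = etaQuotient M (expF M s) τ := fun τ ↦ rfl
  have hGcoe : ∀ τ : ℍ, G τ = etaQuotient M (expG M s) τ := fun τ ↦ rfl
  -- orders at `∞`
  obtain ⟨a, ha⟩ := hs.sum_mul_dvd
  set eG : ℕ := padN M s * ∑ δ ∈ M.divisors, δ with heG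
  have hSG : ∑ δ ∈ M.divisors, (δ : ℤ) * expG M s δ = 24 * (eG : ℕ) := by
    simp only [expG, heG, ← Finset.sum_mul]
    push_cast
    ring
  have hSF' : ∑ δ ∈ M.divisors, (δ : ℤ) * expF M s δ = 24 * (a + eG) := by
    simp only [expF, mul_add, Finset.sum_add_distrib, ha]
    have : ∑ δ ∈ M.divisors, (δ : ℤ) * (24 * (padN M s : ℤ)) = 24 * (eG : ℤ) := by
      simp only [heG, ← Finset.sum_mul]
      push_cast
      ring
    rw [this]
  have hpos : 0 < ∑ δ ∈ M.divisors, (δ : ℤ) * expF M s δ :=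
    Finset.sum_pos (fun δ hδ ↦ mul_pos (by exact_mod_cast Nat.pos_of_mem_divisors hδ) (expF_pos M s hδ))
      ⟨M, hMmem⟩
  have haeG : 0 ≤ a + eG := by rw [hSF'] at hpos; omega
  set eF : ℕ := (a + eG).toNat with heF
  have heF' : (eF : ℤ) = a + eG := Int.toNat_of_nonneg haeG
  have hSF : ∑ δ ∈ M.divisors, (δ : ℤ) * expF M s δ = 24 * (eF : ℕ) := by rw [hSF', heF']
  -- `q`-expansions
  have hFfun : ∀ τ : ℍ, F τ = Periodic.qParam 1 (τ : ℂ) ^ eF * eulerUnit M (expF M s) τ := fun τ ↦ by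
    rw [hFcoe]
    exact etaQuotient_eq_qParam_pow_mul_eulerUnit M _ eF hSF (fun δ hδ ↦ (expF_pos M s hδ).le) τ
  have hGfun : ∀ τ : ℍ, G τ = Periodic.qParam 1 (τ : ℂ) ^ eG * eulerUnit M (expG M s) τ := fun τ ↦ by
    rw [hGcoe]
    exact etaQuotient_eq_qParam_pow_mul_eulerUnit M _ eG hSG (fun δ _ ↦ (expG_pos M s δ).le) τ
  have hqF : qExpansion 1 F = X ^ eF * (etaPos M (expF M s)).map (Int.castRingHom ℂ) := by
    rw [qExpansion_eq_X_pow_mul F (isIntUnitQExp_eulerUnit M _) eF hFfun, qExpansion_eulerUnit]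
  have hqG : qExpansion 1 G = X ^ eG * (etaPos M (expG M s)).map (Int.castRingHom ℂ) := by
    rw [qExpansion_eq_X_pow_mul G (isIntUnitQExp_eulerUnit M _) eG hGfun, qExpansion_eulerUnit]
  -- the power-series identity `etaPos s · etaPos g = etaPos f · etaNeg s`
  have hPS : etaPos M s * etaPos M (expG M s) = etaPos M (expF M s) * etaNeg M s := by
    simp only [etaPos, etaNeg, ← Finset.prod_mul_distrib, ← pow_add]
    refine Finset.prod_congr rfl fun δ hδ ↦ ?_
    congr 1
    have := natAbs_lt_padN M s hδ
    unfold expF expG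
    omega
  have hexp : (∑ δ ∈ M.divisors, (δ : ℤ) * s δ) / 24 + (eG : ℤ) = eF := by
    rw [ha, heF', Int.mul_ediv_cancel_left _ (by norm_num : (24 : ℤ) ≠ 0)]
  have hneg : toLaurent (etaNeg M s) ≠ 0 := toLaurent_ne_zero_of_constantCoeff (constantCoeff_etaNeg M s)
  -- pointwise `E_F = η_s·E_G`
  have hpt : ∀ τ : ℍ, F τ = etaQuotient M s τ * G τ := fun τ ↦ by
    rw [hFcoe, hGcoe, etaQuotient_apply, etaQuotient_apply, etaQuotient_apply, ← Finset.prod_mul_distrib]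
    refine Finset.prod_congr rfl fun δ hδ ↦ ?_
    rw [← zpow_add₀ (eta_natMul_ne_zero (Nat.pos_of_mem_divisors hδ) τ.2)]
    simp only [expF, expG]
  refine ⟨wt M s, F, G, fun τ ↦ ?_, hpt, ?_⟩
  · rw [hGcoe]; exact etaQuotient_ne_zero M _ τ
  · rw [qExpansionL_def, qExpansionL_def, hqG, hqF, ofPowerSeries_X_pow_mul_map,
      ofPowerSeries_X_pow_mul_map, etaLaurent, div_eq_mul_inv]
    calc HahnSeries.single ((∑ δ ∈ M.divisors, (δ : ℤ) * s δ) / 24) (1 : ℂ) *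
          (toLaurent (etaPos M s) * (toLaurent (etaNeg M s))⁻¹) *
          (HahnSeries.single (eG : ℤ) 1 * toLaurent (etaPos M (expG M s)))
        = HahnSeries.single ((∑ δ ∈ M.divisors, (δ : ℤ) * s δ) / 24) (1 : ℂ) * HahnSeries.single (eG : ℤ) 1 *
            (toLaurent (etaPos M s) * toLaurent (etaPos M (expG M s))) * (toLaurent (etaNeg M s))⁻¹ := by
          ring
      _ = HahnSeries.single (eF : ℤ) (1 : ℂ) *
            (toLaurent (etaPos M (expF M s)) * toLaurent (etaNeg M s)) * (toLaurent (etaNeg M s))⁻¹ := by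
          rw [HahnSeries.single_mul_single, mul_one, hexp, ← toLaurent_mul, hPS, toLaurent_mul]
      _ = HahnSeries.single (eF : ℤ) (1 : ℂ) * toLaurent (etaPos M (expF M s)) := by
          rw [mul_assoc, mul_inv_cancel_right₀ hneg]

end Presentation

/-! ## §2 The half vector `s = r/2` -/

/-- For an all-even Newman vector `r` of weight `0`, the half vector `s_δ = r_δ/2` has `Σ s_δ = 0`, `12 ∣ Σ δ s_δ`, `12 ∣ Σ (N/δ) s_δ`
(halves of Newman's congruences), and `η_r = η_s²` pointwise. [folklore] -/
theorem halfVector_spec {N : ℕ} {r : ℕ → ℤ} (hr : NewmanCond N r 0) (hev : ∀ δ ∈ N.divisors, Even (r δ)) :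
    (∑ δ ∈ N.divisors, r δ / 2 = 0) ∧ ((12 : ℤ) ∣ ∑ δ ∈ N.divisors, (δ : ℤ) * (r δ / 2)) ∧
      ((12 : ℤ) ∣ ∑ δ ∈ N.divisors, ((N / δ : ℕ) : ℤ) * (r δ / 2)) ∧
      ∀ τ : ℍ, etaQuotient N r τ = etaQuotient N (fun δ ↦ r δ / 2) τ ^ 2 := by
  have hrs : ∀ δ ∈ N.divisors, r δ = 2 * (r δ / 2) := fun δ hδ ↦ (Int.two_mul_ediv_two_of_even (hev δ hδ)).symm
  have h0 : ∑ δ ∈ N.divisors, r δ = 2 * ∑ δ ∈ N.divisors, r δ / 2 := by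
    rw [Finset.mul_sum]; exact Finset.sum_congr rfl fun δ hδ ↦ hrs δ hδ
  have h1 : ∑ δ ∈ N.divisors, (δ : ℤ) * r δ = 2 * ∑ δ ∈ N.divisors, (δ : ℤ) * (r δ / 2) := by
    rw [Finset.mul_sum]; exact Finset.sum_congr rfl fun δ hδ ↦ by linear_combination (δ : ℤ) * hrs δ hδ
  have h2 : ∑ δ ∈ N.divisors, ((N / δ : ℕ) : ℤ) * r δ = 2 * ∑ δ ∈ N.divisors, ((N / δ : ℕ) : ℤ) * (r δ / 2) := by
    rw [Finset.mul_sum]; exact Finset.sum_congr rfl fun δ hδ ↦ by linear_combination ((N / δ : ℕ) : ℤ) * hrs δ hδ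
  have hk := hr.sum_eq
  have h24a := hr.sum_mul_dvd
  have h24b := hr.sum_div_dvd
  rw [h0] at hk
  rw [h1] at h24a
  rw [h2] at h24b
  refine ⟨by omega, by omega, by omega, fun τ ↦ ?_⟩
  rw [etaQuotient_apply, etaQuotient_apply, ← Finset.prod_pow]
  refine Finset.prod_congr rfl fun δ hδ ↦ ?_
  conv_lhs => rw [hrs δ hδ]
  rw [zpow_mul', zpow_ofNat]

/-! ## §3 The power-series identity `Ξ_ℂ·Ĝ_B²·Ê_G = Ê_F·F̂_A²` -/

/-- **The cuspidal Kummer representative as an identity of `q`-expansions of Γ₀(N)-forms**: if `Ξ·B²·qⁿ¹ = qⁿ²·g·A²` is a cuspidal Kummer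
representative with `Â/B̂·Ĝ_B = F̂_A` and `η̂_r·Ê_G = Ê_F`, then `Ξ_ℂ·Ĝ_B²·Ê_G = Ê_F·F̂_A²` in `ℂ⟦q⟧` (`Ξ̂ = η̂_r·(Â/B̂)²` by N1₂). [folklore] -/
theorem kummer_qExpansion_identity {N : ℕ} [NeZero N] {Ξ : ℚ⟦X⟧} {r : ℕ → ℤ} {g A B : ℤ⟦X⟧}
    (hrep : IsCuspidalKummerRep N Ξ r g A B) {k₁ k₂ : ℤ} {E_F E_G : ModularForm (Gamma0 N) k₁} {F_A G_B : ModularForm (Gamma0 N) k₂}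
    (hEL : CuspidalKummerThree.etaLaurent N r * qExpansionL N E_G = qExpansionL N E_F)
    (hAB : CuspidalKummerThree.toLaurent A / CuspidalKummerThree.toLaurent B * qExpansionL N G_B = qExpansionL N F_A) :
    Ξ.map (algebraMap ℚ ℂ) * UpperHalfPlane.qExpansion 1 ⇑G_B ^ 2 * UpperHalfPlane.qExpansion 1 ⇑E_G =
      UpperHalfPlane.qExpansion 1 ⇑E_F * UpperHalfPlane.qExpansion 1 ⇑F_A ^ 2 := by
  obtain ⟨n₁, n₂, he12, hEq⟩ := SquareRootDescent.sub_eq_sum_div_of_isCuspidalKummerRep hrep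
  obtain ⟨-, hEta, hB, -, -⟩ := hrep
  have hΞL := SquareRootDescent.laurent_sq_eq_of_rep hB hEq
  have hηL : CuspidalKummerThree.etaLaurent N r = HahnSeries.single ((n₂ : ℤ) - n₁) (1 : ℂ) * CuspidalKummerThree.toLaurent g := by
    rw [CubeRootDescent.etaLaurent_eq_of_isEtaUnitSeries hEta, he12]
  apply HahnSeries.ofPowerSeries_injective (Γ := ℤ) (R := ℂ)
  rw [map_mul, map_mul, map_pow, map_mul, map_pow, ← qExpansionL_def, ← qExpansionL_def, ← qExpansionL_def, ← qExpansionL_def,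
    hΞL, ← hηL, ← hAB, ← hEL]
  ring

/-! ## §4 E-an-237 by name -/

/-- **E-an-237 `EvenKummerRepCongruencePeriodic` HOLDS** (an g42, MEMO-an §87; TURNKEY P-an-g42-1): an all-even cuspidal Kummer representative of
`Ξ_T` forces the σ-square root `V_p` of every half-period `p` of `T` to be periodic under `c·{∞,γ∞}_f` for all `γ ∈ Γ₀(N) ∩ Γ(8N)`.
See the module docstring for the proof.  C2 and BSD are NOT proved by this. [cite: Newman1959] [cite: Savitt2025, Thm. 1]
[cite: Manin1972, Prop. 1.4 (shape)] -/
theorem evenKummerRepCongruencePeriodic_holds : KummerShimuraTwo.EvenKummerRepCongruencePeriodic := by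
  intro W _ _ N _ D a ha e he z hz r g A B hrep hev p m₁ m₂ hpΛ h2p h℘ γ hγ w
  have hN : 0 < N := Nat.pos_of_ne_zero (NeZero.ne N)
  have hc0 : D.c ≠ 0 := D.maninConstant_ne_zero_holds
  have hc0' : (D.c : ℂ) ≠ 0 := Int.cast_ne_zero.mpr hc0
  have hNew : NewmanCond N r 0 := hrep.1
  have hh := hrep.2.2.2.1
  -- §2: the half vector and the `Γ(8N)`-invariance of `η_s` (p2 g20, S-an-g42-1)
  set s : ℕ → ℤ := fun δ ↦ r δ / 2 with hs
  obtain ⟨h0s, h1s, h2s, hηsq⟩ := halfVector_spec hNew hev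
  have hηinv : ∀ τ : ℍ, etaQuotient N s ((γ : SL(2, ℤ)) • τ) = etaQuotient N s τ := fun τ ↦
    EtaHalfNewman.etaQuotient_smul_of_mem_Gamma_eight_mul N hN s h0s h1s h2s hγ τ
  -- §1: M1 with witnesses for `r`, and the presentation of `A/B`
  obtain ⟨k₁, E_F, E_G, hEGne, hEpt, hEL⟩ := etaLaurent_presentation N r hNew
  obtain ⟨k₂, F_A, G_B, hGB0, hAB⟩ := (mem_modularFunctionField_iff (N := N)).mp hh
  -- §3: the power-series identity
  set Θc : PowerSeries ℂ := (kummerSeries W D.c (e : ℚ) z).map (algebraMap ℚ ℂ) with hΘc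
  have hPS : Θc * UpperHalfPlane.qExpansion 1 ⇑G_B ^ 2 * UpperHalfPlane.qExpansion 1 ⇑E_G =
      UpperHalfPlane.qExpansion 1 ⇑E_F * UpperHalfPlane.qExpansion 1 ⇑F_A ^ 2 :=
    kummer_qExpansion_identity hrep hEL (by exact hAB)
  -- evaluation near `i∞`
  obtain ⟨B₀, hB₀⟩ := kummerSquareAnalyticDictionary W D a ha hc0 (e : ℚ) z hz
  have hcoef : ∀ τ : ℍ, B₀ < τ.im →
      HasSum (fun n : ℕ ↦ coeff n Θc * Function.Periodic.qParam 1 (τ : ℂ) ^ n)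
        (shortT D τ ^ 2 * (shortX D τ - ((shortRoot W D.c (e : ℚ) : ℚ) : ℂ))) := by
    intro τ hτ
    have h := hB₀ τ hτ
    simp only [hΘc, PowerSeries.coeff_map, eq_ratCast]
    exact h
  have heval : ∀ τ : ℍ, B₀ < τ.im →
      shortT D τ ^ 2 * (shortX D τ - ((shortRoot W D.c (e : ℚ) : ℚ) : ℂ)) * G_B τ ^ 2 * E_G τ = E_F τ * F_A τ ^ 2 := by
    intro τ hτ
    have hL := hasSum_coeff_mul_pow_mul (hasSum_coeff_mul_pow_mul (hcoef τ hτ) (hasSum_coeff_qExpansion_pow G_B τ 2))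
      (hasSum_qExpansion_modularForm_gamma0 E_G τ)
    have hR := hasSum_coeff_mul_pow_mul (hasSum_qExpansion_modularForm_gamma0 E_F τ) (hasSum_coeff_qExpansion_pow F_A τ 2)
    rw [hPS] at hL
    exact hL.unique hR
  -- S3₂ for the GIVEN half-period `p`
  have hX : ((shortRoot W D.c (e : ℚ) : ℚ) : ℂ) = (D.c : ℂ) ^ 2 * ℘[D.L] p := shortRoot_eq_of_weierstrassP_eq W D.c h℘
  obtain ⟨C, hC0, hV⟩ := exists_weierstrassP_sub_eq_mul_sigmaSqRoot_sq D.L hpΛ h2p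
  -- the carriers `F = η_s·F_A`, `G = G_B`
  set Fη : ℍ → ℂ := fun τ ↦ etaQuotient N s τ * F_A τ with hFη
  have hS4 : ∀ τ : ℍ, B₀ < τ.im → (D.c : ℂ) * eichlerIntegral D.f τ ∉ D.L.lattice →
      Fη τ ^ 2 = (D.c : ℂ) ^ 2 * C *
        (shortT D τ * sigmaSqRoot D.L p (m₁ * D.L.η₁ + m₂ * D.L.η₂) ((D.c : ℂ) * eichlerIntegral D.f τ)) ^ 2 * G_B τ ^ 2 := by
    intro τ hτ hw
    have hid := heval τ hτ
    rw [hEpt τ, hηsq τ, hX, shortX, ← mul_sub, hV _ hw] at hid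
    have hE := hEGne τ
    have hid' : E_G τ * (Fη τ ^ 2 - (D.c : ℂ) ^ 2 * C *
        (shortT D τ * sigmaSqRoot D.L p (m₁ * D.L.η₁ + m₂ * D.L.η₂) ((D.c : ℂ) * eichlerIntegral D.f τ)) ^ 2 * G_B τ ^ 2) = 0 := by
      rw [hFη]
      linear_combination -hid
    exact sub_eq_zero.mp ((mul_eq_zero.mp hid').resolve_left hE)
  have hFηd : MDifferentiable 𝓘(ℂ) 𝓘(ℂ) Fη := (mdifferentiable_etaQuotient N s).mul (ModularFormClass.holo F_A)
  have hGB : ∃ τ : ℍ, G_B τ ≠ 0 := by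
    by_contra h
    push Not at h
    exact hGB0 (DFunLike.ext G_B 0 fun τ ↦ by rw [h τ]; rfl)
  refine sigmaSqRootMonodromy_of_automorphy W D p (m₁ * D.L.η₁ + m₂ * D.L.η₂) Fη G_B hFηd (ModularFormClass.holo G_B) hGB
    ((D.c : ℂ) ^ 2 * C) B₀ (mul_ne_zero (pow_ne_zero 2 hc0') hC0) hS4 γ (fun τ ↦ ?_) w
  refine ⟨UpperHalfPlane.denom (γ : SL(2, ℤ)) τ ^ k₂, zpow_ne_zero k₂ (UpperHalfPlane.denom_ne_zero _ τ), ?_,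
    SlashInvariantForm.slash_action_eqn_SL'' G_B γ.2 τ⟩
  rw [hFη]
  simp only
  rw [hηinv τ, SlashInvariantForm.slash_action_eqn_SL'' F_A γ.2 τ]
  ring

end Summit.BirchSwinnertonDyer.BirchSwinnertonDyer.Theorems.ManinLocalTwoThree.EvenKummerCongruence

end
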